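import Summits.QuantumFields.YangMills.Theorems.FluctuationComparisonRegPrIntLS2BetaSmoothMovedSizes
import Summits.QuantumFields.YangMills.Theorems.FluctuationComparisonRegPrIntLS2BetaArcBondSplit
import HarnessLib

/-!
# S2β · GAP♯∘ — (γ) «(SUP-DECAY)₀ AT THE SMOOTH-MOVED TRIPLE»: the per-bond sup letter `hζc : ∀ ℓ, ‖ζ ℓ‖ ≤ c·(L⁻¹)^{K−J}` of the c₁ column's junction∕R-rows
# (✓`junctionEnergy_le_purse_of_supDecay`, the (e′) station), INHABITED at the smooth-moved triple of ✓`residualKnit` from Thm 2's own arc letter on the twist `E` ((1.36)₁) and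
# the fine-small commutator factor `E′` of (α-SIZES): `arc(E·E′) ≤ arc E + (π∕2)·dist1 E′ ≤ p + (π∕2)·(4σ̃ + γ)`

Cell `ym3-torus` (rung R3 = continuum `SU(2)` YM₃ on T³ at fixed lattice data — NOT d = 4, NOT infinite volume, NOT a mass gap, NOT Clay).  Width seat
`ym-ust-20520-w5` (gen 29), explicit-unit helper on crux `stmt-QuantumFields-20520`, LINE g18-1 S2β (registry untouched), organ GAP♯∘, node (RES-u) ∕ c₁ column (architect px17 g23
2026-09-01T03:09Z∕04:30Z: «`hζc` = (SUP-DECAY)₀ at the representative, the same letter (REG)@rep supplies for `O·M`∕`O²`»).  At the smooth-moved triple `((u↓)⁻¹•V, û•W, u⁻¹•U)`,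
`W := r•U₀` the smooth residual copy, the relative bond variable is `E b·E′ b` with `E′ b := W b·((û•W) b)⁻¹` (✓p840523 `relChord_smoothMoved`), `dist1 (E′ b) ≤ 4σ̃ + γ`
(✓`dist1_movedCopyRel_le_SU`); THIS FILE turns that into the ARC currency of the ζ-presentation `U′ = expPoint ζ · U₀′`:
* §1 `norm_logVec_mul_le_arc_add_dist1 (X Y) : arc (X·Y) ≤ arc X + (π∕2)·dist1 Y` (✓`norm_logVec_su2Quat_mul_le` + ✓`norm_logVec_le_pi_div_two_mul_dist1`).
* §2 ★`arc_rel_smoothMoved_le (hrep) (hE : ∀ b, arc (E b) ≤ p) (hσ̃) (hγ) : ∀ b, arc ((u⁻¹•U) b·((û•W) b)⁻¹) ≤ p + (π∕2)·(4σ̃ + γ)`.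
* §3 THE ζ-PRESENTATION: `ζ ℓ := logVec (su2Quat (U′ ℓ·(U₀′ ℓ)⁻¹))` reconstructs `U′` (`expPoint_logVec_rel_mul`, lit ✓`expPoint_logVec`) and obeys ★★`hζc_smoothMoved : ∀ ℓ, ‖ζ ℓ‖ ≤ p + (π∕2)(4σ̃+γ)`;
  η-FACTORED: `p = p₀·η, σ̃ = σ₀·η, γ = γ₀·η` (`η = (L⁻¹)^{K−J}`) ⟹ ★★`hζc_smoothMoved_eta : ∀ ℓ, ‖ζ ℓ‖ ≤ (p₀ + π∕2·(4σ₀ + γ₀)) * ((F.L:ℝ)⁻¹)^(K−J)` — `hζc`'s shape with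
  `c := p₀ + (π∕2)(4σ₀ + γ₀)` (✓`residualKnit`: `σ₀ = s₀ + 2πτ_β`, `γ₀ = 2π(4σ_V + e)`; `p₀ = B₁s` from Thm 2 (1.36)₁ in arc currency — DISPLAYED).
`--kind proof --supports stmt-QuantumFields-20520 --as helper`, DEFINITION-FREE (0 `def`, 0 `instance`, 0 `sorry`; default heartbeats).

HONEST.  Two triangle inequalities and a chart identity over landed lemmas; `hrep`∕`hE`∕`hσ̃`∕`hγ` are HYPOTHESES (the letters of ✓`residualKnit`; `hE` = [Balaban1985RegularSpaces]
(1.36)₁ on Thm 2's `A`, UNPROVED at `L = 3` via `B8Thm2AtT3Members`); nothing of Bałaban's analysis is asserted or proved ([Balaban1985RegularSpaces] (1.36) p.82, Thm 2 p.83;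
[Balaban1985Averaging] (8) p.18); GAP♯∘ (`stub_uniformFibreGapOrbit`, 0∕5), the five REGISTERED stubs, S2β, crux 20520, 19936, 19200, `YM3TorusSU2` NOT proved; no summit statement
is proved by a helper; rung R3 = SU(2) YM₃ on T³ — NOT d = 4, NOT infinite volume, NOT a mass gap, NOT Clay; the Yang–Mills mass gap is NOT proved.
-/

set_option autoImplicit false

noncomputable section

namespace Summit.QuantumFields.YangMills.Theorems.FluctuationComparisonRegPrIntLS2BetaSupDecayAtSmoothMoved

open scoped Real
open Literature.MathematicalPhysics.QuantumLattice (su2Quat)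
open Literature.MathematicalPhysics.QuantumFieldTheory.Balaban1983to89
open T4Continuum T3ContinuumYM3Torus
open T4CubeChartGnomonic (SU2)
open T4HaarSU2ExpChart (expPoint)
open T4ExpWindowSmallField (logVec expPoint_logVec)
open Summit.QuantumFields.YangMills.Theorems.FluctuationComparisonRegPrIntLS2BetaArcBondSplit (norm_logVec_su2Quat_mul_le)
open Summit.QuantumFields.YangMills.Theorems.FluctuationComparisonRegPrIntLS2BetaDistributedHolonomySU2 (norm_logVec_le_pi_div_two_mul_dist1)
open Summit.QuantumFields.YangMills.Theorems.FluctuationComparisonRegPrIntLS2BetaSmoothMovedSizes (relChord_smoothMoved dist1_movedCopyRel_le_SU)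

/-! ## §1 Arc of a product: arc letter on the first factor, chord letter on the second -/

/-- `arc (X·Y) ≤ arc X + (π∕2)·dist1 Y` (arc subadditivity ✓`norm_logVec_su2Quat_mul_le` + «arc ≤ (π∕2)·chord» ✓`norm_logVec_le_pi_div_two_mul_dist1`). [folklore] -/
theorem norm_logVec_mul_le_arc_add_dist1 (X Y : SU2) :
    ‖logVec (su2Quat (X * Y))‖ ≤ ‖logVec (su2Quat X)‖ + π / 2 * dist1 Y := by
  have h1 := norm_logVec_su2Quat_mul_le X Y
  have h2 := norm_logVec_le_pi_div_two_mul_dist1 Y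
  linarith

/-! ## §2 The relative arc at the smooth-moved triple -/

section Moved

variable {P : Params} {j : ℕ}

/-- ★ **THE RELATIVE ARC AT THE SMOOTH-MOVED TRIPLE**: `u⁻¹•U = E·W` (Thm 2's representative of the pair `(W, U)`), arcs of the twist `E` `≤ p`, bonds of `W` `≤ σ̃`, fine gradient of the
lift `û` `≤ γ` ⟹ `arc ((u⁻¹•U) b·((û•W) b)⁻¹) ≤ p + (π∕2)·(4σ̃ + γ)` on every bond. [cite: Balaban1985RegularSpaces, (1.36) p.82, Thm 2 p.83; Balaban1985Averaging, (8) p.18] -/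
theorem arc_rel_smoothMoved_le {u û : Site P j → SU2} {E : PBond P j → SU2} {W U : GaugeField P j SU2} {p σ γ : ℝ}
    (hrep : GaugeField.gaugeAct (fun x => (u x)⁻¹) U = fun b => E b * W b)
    (hE : ∀ b : PBond P j, ‖logVec (su2Quat (E b))‖ ≤ p)
    (hσ : ∀ b : PBond P j, dist1 (W b) ≤ σ) (hγ : ∀ b : PBond P j, dist1 (û b.tgt * (û b.src)⁻¹) ≤ γ) :
    ∀ b : PBond P j, ‖logVec (su2Quat (GaugeField.gaugeAct (fun x => (u x)⁻¹) U b * (GaugeField.gaugeAct û W b)⁻¹))‖ ≤ p + π / 2 * (4 * σ + γ) := by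
  intro b
  rw [relChord_smoothMoved u û E W U hrep b]
  have h1 := norm_logVec_mul_le_arc_add_dist1 (E b) (W b * (GaugeField.gaugeAct û W b)⁻¹)
  have h2 := dist1_movedCopyRel_le_SU hσ hγ b
  have hπ : 0 ≤ π / 2 := by positivity
  nlinarith [hE b, mul_le_mul_of_nonneg_left h2 hπ]

end Moved

/-! ## §3 The ζ-presentation of the moved pair and `hζc` -/

section Zeta

variable {P : Params} {j : ℕ}

/-- THE ζ-PRESENTATION RECONSTRUCTS THE FIELD: with `ζ ℓ := logVec (su2Quat (U′ ℓ·(U₀′ ℓ)⁻¹))`, `expPoint (ζ ℓ)·U₀′ ℓ = U′ ℓ` (lit ✓`expPoint_logVec`).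
[cite: Balaban1985RegularSpaces, (1.29) p.81] -/
theorem expPoint_logVec_rel_mul (U' U₀' : GaugeField P j SU2) :
    (fun ℓ => expPoint (logVec (su2Quat (U' ℓ * (U₀' ℓ)⁻¹))) * U₀' ℓ) = U' := by
  funext ℓ
  rw [expPoint_logVec, inv_mul_cancel_right]

/-- ★★ **`hζc` AT THE SMOOTH-MOVED TRIPLE**: for `U′ := u⁻¹•U`, `U₀′ := û•W` and `ζ ℓ := logVec (su2Quat (U′ ℓ·(U₀′ ℓ)⁻¹))`: `‖ζ ℓ‖ ≤ p + (π∕2)·(4σ̃ + γ)` on every bond.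
[cite: Balaban1985RegularSpaces, (1.36) p.82, Thm 2 p.83] -/
theorem hζc_smoothMoved {u û : Site P j → SU2} {E : PBond P j → SU2} {W U : GaugeField P j SU2} {p σ γ : ℝ}
    (hrep : GaugeField.gaugeAct (fun x => (u x)⁻¹) U = fun b => E b * W b)
    (hE : ∀ b : PBond P j, ‖logVec (su2Quat (E b))‖ ≤ p)
    (hσ : ∀ b : PBond P j, dist1 (W b) ≤ σ) (hγ : ∀ b : PBond P j, dist1 (û b.tgt * (û b.src)⁻¹) ≤ γ) :
    ∀ ℓ : PBond P j,
      ‖(fun ℓ => logVec (su2Quat (GaugeField.gaugeAct (fun x => (u x)⁻¹) U ℓ * (GaugeField.gaugeAct û W ℓ)⁻¹))) ℓ‖ ≤ p + π / 2 * (4 * σ + γ) :=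
  arc_rel_smoothMoved_le hrep hE hσ hγ

end Zeta

section Eta

variable (F : T3Family) {J K : ℕ}

/-- ★★ **η-FACTORED EDITION** (the `hζc` binder's shape `c * ((F.L : ℝ)⁻¹) ^ (K - J)` VERBATIM): if the twist's arcs are `≤ p₀·η`, the smooth copy's bonds `≤ σ₀·η` and the lift's
fine gradient `≤ γ₀·η` with `η := (L⁻¹)^{K−J}`, then `‖ζ ℓ‖ ≤ (p₀ + π∕2·(4σ₀ + γ₀))·η` — `c := p₀ + (π∕2)(4σ₀ + γ₀)` (✓`residualKnit`: `σ₀ = s₀ + 2π·τ_β`, `γ₀ = 2π·(4σ_V + e)`;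
`p₀ = B₁·s` from (1.36)₁). [cite: Balaban1985RegularSpaces, (1.36) p.82, Thm 2 p.83] -/
theorem hζc_smoothMoved_eta {u û : Site (F.P K) 0 → SU2} {E : PBond (F.P K) 0 → SU2} {W U : GaugeField (F.P K) 0 SU2} {p₀ σ₀ γ₀ : ℝ}
    (hrep : GaugeField.gaugeAct (fun x => (u x)⁻¹) U = fun b => E b * W b)
    (hE : ∀ b : PBond (F.P K) 0, ‖logVec (su2Quat (E b))‖ ≤ p₀ * ((F.L : ℝ)⁻¹) ^ (K - J))
    (hσ : ∀ b : PBond (F.P K) 0, dist1 (W b) ≤ σ₀ * ((F.L : ℝ)⁻¹) ^ (K - J))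
    (hγ : ∀ b : PBond (F.P K) 0, dist1 (û b.tgt * (û b.src)⁻¹) ≤ γ₀ * ((F.L : ℝ)⁻¹) ^ (K - J)) :
    ∀ ℓ : PBond (F.P K) 0,
      ‖(fun ℓ => logVec (su2Quat (GaugeField.gaugeAct (fun x => (u x)⁻¹) U ℓ * (GaugeField.gaugeAct û W ℓ)⁻¹))) ℓ‖ ≤
        (p₀ + π / 2 * (4 * σ₀ + γ₀)) * ((F.L : ℝ)⁻¹) ^ (K - J) := by
  intro ℓ
  have h := hζc_smoothMoved hrep hE hσ hγ ℓ
  have e : p₀ * ((F.L : ℝ)⁻¹) ^ (K - J) + π / 2 * (4 * (σ₀ * ((F.L : ℝ)⁻¹) ^ (K - J)) + γ₀ * ((F.L : ℝ)⁻¹) ^ (K - J)) =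
      (p₀ + π / 2 * (4 * σ₀ + γ₀)) * ((F.L : ℝ)⁻¹) ^ (K - J) := by ring
  rw [← e]
  exact h

end Eta

end Summit.QuantumFields.YangMills.Theorems.FluctuationComparisonRegPrIntLS2BetaSupDecayAtSmoothMoved

end
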